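import Summits.CriticalPhenomena.PercolationContinuityZ3.Theorems.PercNearOneGluingNoHeavyLowerTailSahiCombHybridCoeff

/-!
# The comb hierarchy for Sahi's `E_k`: the TRIANGLE CLASS — frozen and free coordinates of a profile, the three SECTIONS, the
# TRI integrand and the fibre parametrisation (objects of the class-T bridge)

Support file of the one-cut programme (crux `NoHeavyLowerTail`, stmt-CriticalPhenomena-4575; cell `prim-masterthm`, seat P5 gen 8;
report `P5-LORENTZIAN-TEST.md` §10.3 (the triangle class), §13).

A triple of events `U_0, U_1, U_2 ⊆ 2^ι` with declared supports `E_0, E_1, E_2` is of CLASS T when no coordinate is declared by all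
three (`SahiHybrid.IsClassT`).  Fix a reduced profile `s` (tree `SahiHybrid.redProfile`, file `…SahiCombHybridCoeff`).  In the fibre
of `s` every coordinate is either FROZEN (open in every interested copy — `frozenOpen` — or closed in all of them) or FREE: declared by
exactly two members `i < j` with `s_e = 1`, so that exactly one of the two interested copies is open there (`freePair E s i j`).
This file only sets up the OBJECTS (definitions + their unfolding lemmas); the identities are proved in `…SahiCombTriangleBridge`:

* `SahiHybrid.IsClassT`, `card_slot_three`, `redProfile_three` — the class and the coordinatewise form of slots / reduced profiles;
* `SahiHybrid.freePair`, `SahiHybrid.frozenOpen` — the free pair blocks and the frozen-open coordinates of a profile;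
* `SahiHybrid.secF/secG/secH` — the SECTIONS `f(x,y) = 1_{U_0}(O_0 ∪ x ∪ y)`, `g(x,z) = 1_{U_1}(O_1 ∪ x ∪ z)`, `h(y,z) = 1_{U_2}(O_2 ∪ y ∪ z)`
  (`x ⊆ freePair 0 1`, `y ⊆ freePair 0 2`, `z ⊆ freePair 1 2`; three jointly determined `{0,1}`-valued functions of two blocks each);
* `SahiHybrid.triTerm` — the TRI integrand `h(y,z)·[2f(x,y)g(x,z) − f(x̄,ȳ)g(x,z) − f(x̄,y)g(x,z̄) − f(x,ȳ)g(x,z̄) + f(x̄,ȳ)g(x,z̄)]`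
  (report §10.3; bars = complements inside the free blocks);
* `SahiHybrid.triParam` — the fibre parametrisation `(copy 0, copy 1, copy 2) = (O_0 ∪ x̄ ∪ ȳ, O_1 ∪ x ∪ z̄, O_2 ∪ y ∪ z)`;
* `SahiHybrid.ind_eq_of_agree` — indicators of determined events agree on configurations agreeing on the support;
* `SahiHybrid.famH/famF/famG` — the families of the thin-edge lattice `Set ↥P × Set ↥Q` cut out by the three sections (the five up-sets of
  the thin-edge reduction, file `…SahiCombTriangleThinEdge`);
* `SahiHybrid.boolCompl` — complementation of a Boolean algebra as a self-bijection (the antipode of the thin-edge lattices).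
HONEST LABEL: definitions and unfolding lemmas only; (M⁺⁺-3)/`C_3` stay OPEN. [this work]
-/

noncomputable section

open scoped Classical

namespace Summit.CriticalPhenomena.PercolationContinuityZ3.Theorems

open Finset Function
open Literature.Combinatorics.Sahi2008
open Literature.Probability.Percolation (DeterminedBy determinedBy_iff)
open Literature.Probability.Percolation.DecisionTree (ind ind_of_mem ind_of_not_mem ind_nonneg)
open SahiComb

namespace SahiHybrid

variable {ι : Type}

/-! ### Slots and reduced profiles of three members, coordinatewise -/

/-- **Class T**: no coordinate is declared by all three members. [this work] -/
def IsClassT (E : Fin 3 → Finset ι) : Prop := ∀ e, ¬ (e ∈ E 0 ∧ e ∈ E 1 ∧ e ∈ E 2)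

/-- The number of members interested in `e`, as a sum of three indicators. [this work] -/
theorem card_slot_three (E : Fin 3 → Finset ι) (e : ι) :
    (slot E e).card = (if e ∈ E 0 then 1 else 0) + (if e ∈ E 1 then 1 else 0) + (if e ∈ E 2 then 1 else 0) := by
  unfold slot
  rw [card_filter, Fin.sum_univ_three]

/-- The reduced profile of three copies at `e`, as a sum of three indicators. [this work] -/
theorem redProfile_three (E : Fin 3 → Finset ι) (ξ : Fin 3 → Set ι) (e : ι) :
    redProfile E ξ e = (if e ∈ E 0 ∧ e ∈ ξ 0 then 1 else 0) + (if e ∈ E 1 ∧ e ∈ ξ 1 then 1 else 0)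
      + (if e ∈ E 2 ∧ e ∈ ξ 2 then 1 else 0) := by
  unfold redProfile slot
  rw [filter_filter, card_filter, Fin.sum_univ_three]

/-! ### Frozen and free coordinates of a profile; the sections; the parametrisation -/

section Param

variable (E : Fin 3 → Finset ι) (s : ι → ℕ)

/-- The FREE block of the pair `{i, j}` at profile `s`: coordinates declared by `i` and `j` with exactly one open copy. [this work] -/
def freePair (i j : Fin 3) : Set ι := {e | e ∈ E i ∧ e ∈ E j ∧ s e = 1}

/-- The FROZEN-OPEN coordinates of member `i` at profile `s`: declared by `i` and open in every interested copy. [this work] -/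
def frozenOpen (i : Fin 3) : Set ι := {e | e ∈ E i ∧ s e = (slot E e).card}

variable (U : Fin 3 → Set (Set ι))

/-- The section `f(x,y) = 1_{U_0}(O_0 ∪ x ∪ y)` of member `0` (`x ⊆ freePair 0 1`, `y ⊆ freePair 0 2`). [this work] -/
def secF (x y : Set ι) : ℝ := ind (U 0) (frozenOpen E s 0 ∪ x ∪ y)

/-- The section `g(x,z) = 1_{U_1}(O_1 ∪ x ∪ z)` of member `1` (`x ⊆ freePair 0 1`, `z ⊆ freePair 1 2`). [this work] -/
def secG (x z : Set ι) : ℝ := ind (U 1) (frozenOpen E s 1 ∪ x ∪ z)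

/-- The section `h(y,z) = 1_{U_2}(O_2 ∪ y ∪ z)` of member `2` (`y ⊆ freePair 0 2`, `z ⊆ freePair 1 2`). [this work] -/
def secH (y z : Set ι) : ℝ := ind (U 2) (frozenOpen E s 2 ∪ y ∪ z)

/-- **The TRI integrand** (report §10.3):
`h(y,z)·[2f(x,y)g(x,z) − f(x̄,ȳ)g(x,z) − f(x̄,y)g(x,z̄) − f(x,ȳ)g(x,z̄) + f(x̄,ȳ)g(x,z̄)]`, bars = complements inside the free blocks. [this work] -/
def triTerm (x y z : Set ι) : ℝ :=
  secH E s U y z *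
    (2 * secF E s U x y * secG E s U x z
      - secF E s U (freePair E s 0 1 \ x) (freePair E s 0 2 \ y) * secG E s U x z
      - secF E s U (freePair E s 0 1 \ x) y * secG E s U x (freePair E s 1 2 \ z)
      - secF E s U x (freePair E s 0 2 \ y) * secG E s U x (freePair E s 1 2 \ z)
      + secF E s U (freePair E s 0 1 \ x) (freePair E s 0 2 \ y) * secG E s U x (freePair E s 1 2 \ z))

/-- **The fibre parametrisation**: copy `0 = O_0 ∪ x̄ ∪ ȳ`, copy `1 = O_1 ∪ x ∪ z̄`, copy `2 = O_2 ∪ y ∪ z`. [this work] -/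
def triParam (x y z : Set ι) : Fin 3 → Set ι :=
  ![frozenOpen E s 0 ∪ (freePair E s 0 1 \ x) ∪ (freePair E s 0 2 \ y),
    frozenOpen E s 1 ∪ x ∪ (freePair E s 1 2 \ z),
    frozenOpen E s 2 ∪ y ∪ z]

/-- Copy `0` of the parametrisation. [this work] -/
@[simp] theorem triParam_zero (x y z : Set ι) :
    triParam E s x y z 0 = frozenOpen E s 0 ∪ (freePair E s 0 1 \ x) ∪ (freePair E s 0 2 \ y) := rfl

/-- Copy `1` of the parametrisation. [this work] -/
@[simp] theorem triParam_one (x y z : Set ι) :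
    triParam E s x y z 1 = frozenOpen E s 1 ∪ x ∪ (freePair E s 1 2 \ z) := rfl

/-- Copy `2` of the parametrisation. [this work] -/
@[simp] theorem triParam_two (x y z : Set ι) : triParam E s x y z 2 = frozenOpen E s 2 ∪ y ∪ z := rfl

end Param

/-! ### Indicators of determined events -/

/-- Configurations agreeing on the declared support have the same indicator. [this work] -/
theorem ind_eq_of_agree {A : Set (Set ι)} {F : Finset ι} (hA : DeterminedBy A ↑F) {a b : Set ι}
    (h : ∀ e ∈ F, (e ∈ a ↔ e ∈ b)) : ind A a = ind A b := by
  have hdet : a ∩ ↑F = b ∩ ↑F := by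
    ext e
    simp only [Set.mem_inter_iff, mem_coe]
    constructor
    · rintro ⟨hea, he⟩; exact ⟨(h e he).1 hea, he⟩
    · rintro ⟨heb, he⟩; exact ⟨(h e he).2 heb, he⟩
  have hiff : a ∈ A ↔ b ∈ A := (determinedBy_iff A _).1 hA a b hdet
  by_cases ha : a ∈ A
  · rw [ind_of_mem ha, ind_of_mem (hiff.1 ha)]
  · rw [ind_of_not_mem ha, ind_of_not_mem fun hb => ha (hiff.2 hb)]

/-! ### The thin-edge lattice families -/

section ThinEdgeObjects

variable [Fintype ι]

/-- Points of the thin-edge lattice `W = Set ↥P × Set ↥Q` name pairs `(y, z)`, `y ⊆ P`, `z ⊆ Q` (via `Subtype.val ''`); `famH A O P Q`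
is the family of points whose configuration `O ∪ y ∪ z` lies in the event `A` (used with `A = U 2`, `O = frozenOpen E s 2`). [this work] -/
def famH (A : Set (Set ι)) (O : Set ι) (P Q : Set ι) : Finset (Set ↥P × Set ↥Q) :=
  univ.filter fun w => O ∪ Subtype.val '' w.1 ∪ Subtype.val '' w.2 ∈ A

/-- The family of points `(y, z)` with `O ∪ x ∪ y ∈ A` (a cylinder over the first factor; used with `A = U 0`, `O = frozenOpen E s 0`,
`x` a subset of the free block `freePair E s 0 1`). [this work] -/
def famF (A : Set (Set ι)) (O x : Set ι) (P Q : Set ι) : Finset (Set ↥P × Set ↥Q) :=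
  univ.filter fun w => O ∪ x ∪ Subtype.val '' w.1 ∈ A

/-- The family of points `(y, z)` with `O ∪ x ∪ z ∈ A` (a cylinder over the second factor; used with `A = U 1`, `O = frozenOpen E s 1`). [this work] -/
def famG (A : Set (Set ι)) (O x : Set ι) (P Q : Set ι) : Finset (Set ↥P × Set ↥Q) :=
  univ.filter fun w => O ∪ x ∪ Subtype.val '' w.2 ∈ A

/-- Membership in `famH`. [this work] -/
theorem mem_famH {A : Set (Set ι)} {O P Q : Set ι} {w : Set ↥P × Set ↥Q} :
    w ∈ famH A O P Q ↔ O ∪ Subtype.val '' w.1 ∪ Subtype.val '' w.2 ∈ A := by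
  simp [famH]

/-- Membership in `famF`. [this work] -/
theorem mem_famF {A : Set (Set ι)} {O x P Q : Set ι} {w : Set ↥P × Set ↥Q} :
    w ∈ famF A O x P Q ↔ O ∪ x ∪ Subtype.val '' w.1 ∈ A := by
  simp [famF]

/-- Membership in `famG`. [this work] -/
theorem mem_famG {A : Set (Set ι)} {O x P Q : Set ι} {w : Set ↥P × Set ↥Q} :
    w ∈ famG A O x P Q ↔ O ∪ x ∪ Subtype.val '' w.2 ∈ A := by
  simp [famG]

end ThinEdgeObjects

/-! ### Complementation as a self-bijection -/

/-- Complementation of a Boolean algebra as a self-bijection (an involution). [folklore] -/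
def boolCompl (α : Type*) [BooleanAlgebra α] : α ≃ α := ⟨compl, compl, compl_compl, compl_compl⟩

/-- `boolCompl a = aᶜ`. [folklore] -/
@[simp] theorem boolCompl_apply {α : Type*} [BooleanAlgebra α] (a : α) : boolCompl α a = aᶜ := rfl

/-- Complementation reverses the order. [folklore] -/
theorem boolCompl_le_iff {α : Type*} [BooleanAlgebra α] (a b : α) : boolCompl α a ≤ boolCompl α b ↔ b ≤ a :=
  compl_le_compl_iff_le

end SahiHybrid

end Summit.CriticalPhenomena.PercolationContinuityZ3.Theorems
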